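import Literature.Topology.PlanarFoliations.ProngStar
import HarnessLib

/-!
# Shrinking a prong star

Topic: Topology / PlanarFoliations, sequel to `ProngStar.lean`. An `n`-prong star `P` at `v`
(sectors `S j` with half flow box coordinates onto `[0, ρ] × [-ρ, ρ]`) can be **shrunk** to any
size `ρ' ∈ (0, ρ]`: the sub-sectors `{z ∈ S j | b j z ≤ ρ', |H z| ≤ ρ'}` with the same
coordinates form an `n`-prong star of size `ρ'` (`ProngStar.restrict`), and for `ρ'` small its
sectors lie in any given neighbourhood of `v` (`ProngStar.exists_restrict_subset`) — so a prong
star may always be assumed to lie in a prescribed ball around its puncture (used to fit the stars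
of the punctures into the balls of a `PunctureData`).

* `ProngStar.restrict` (**definition**, all fields **proved**);
* `ProngStar.restrict_S_subset`, `ProngStar.mem_restrict_S_iff` (**proved**);
* `ProngStar.exists_restrict_subset` (**proved**).

All statements are [folklore].
-/

noncomputable section

open Set Filter Function Metric
open _root_.Topology
open Literature.Topology.FourManifolds Literature.Topology.FourManifolds.Foliation

namespace Literature.Topology.PlanarFoliations

variable {X : Type*} [TopologicalSpace X] {F : Foliation ℝ X} {ι : X → ℂ} {v : ℂ} {n : ℕ}

namespace ProngStar

variable (P : ProngStar F ι v n)

/-- The shrunk sector: the points of `S j` with coordinates in `[0, ρ'] × [-ρ', ρ']`. [folklore] -/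
def subS (ρ' : ℝ) (j : ZMod n) : Set ℂ := {z ∈ P.S j | P.b j z ≤ ρ' ∧ |P.H z| ≤ ρ'}

/-- Membership in the shrunk sector. [folklore] -/
theorem mem_subS_iff {ρ' : ℝ} {j : ZMod n} {z : ℂ} :
    z ∈ P.subS ρ' j ↔ z ∈ P.S j ∧ P.b j z ≤ ρ' ∧ |P.H z| ≤ ρ' := Iff.rfl

/-- The shrunk sector lies in the sector. [folklore] -/
theorem subS_subset (ρ' : ℝ) (j : ZMod n) : P.subS ρ' j ⊆ P.S j := fun _ hz ↦ hz.1

/-- The shrunk sector is the part of the sector over the small half square. [folklore] -/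
theorem subS_eq (ρ' : ℝ) (j : ZMod n) :
    P.subS ρ' j = P.S j ∩ P.chart j ⁻¹' (Iic ρ' ×ˢ Icc (-ρ') ρ') := by
  ext z
  simp only [subS, mem_setOf_eq, mem_inter_iff, mem_preimage, mem_prod, chart_apply, mem_Iic, mem_Icc, abs_le]

/-- The shrunk sectors are compact. [folklore] -/
theorem isCompact_subS (ρ' : ℝ) (j : ZMod n) : IsCompact (P.subS ρ' j) := by
  rw [subS_eq]
  exact (P.isCompact j).of_isClosed_subset
    ((P.continuousOn_chart j).preimage_isClosed_of_isClosed (P.isCompact j).isClosed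
      (isClosed_Iic.prod isClosed_Icc)) inter_subset_left

/-- `v` is in every shrunk sector (for `ρ' ≥ 0`). [folklore] -/
theorem mem_subS {ρ' : ℝ} (hρ' : 0 ≤ ρ') (j : ZMod n) : v ∈ P.subS ρ' j :=
  ⟨P.mem j, by rw [P.b_v]; exact hρ', by rw [P.H_v, abs_zero]; exact hρ'⟩

/-- **The shrunk sectors cover a neighbourhood of `v`** (for `ρ' > 0`). [folklore] -/
theorem iUnion_subS_mem_nhds [NeZero n] {ρ' : ℝ} (hρ' : 0 < ρ') : (⋃ j, P.subS ρ' j) ∈ 𝓝 v := by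
  classical
  -- near `v`, inside `S j`, both coordinates are small
  have hsmall : ∀ j, ∃ U ∈ 𝓝 v, ∀ z ∈ U, z ∈ P.S j → P.b j z ≤ ρ' ∧ |P.H z| ≤ ρ' := by
    intro j
    have hb : ContinuousWithinAt (P.b j) (P.S j) v := P.continuousOn_b j v (P.mem j)
    have hH : ContinuousWithinAt P.H (P.S j) v := P.continuousOn_H j v (P.mem j)
    have h₁ : ∀ᶠ z in 𝓝[P.S j] v, P.b j z < ρ' := by
      have := hb.eventually (Iio_mem_nhds (show P.b j v < ρ' by rw [P.b_v]; exact hρ'))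
      exact this
    have h₂ : ∀ᶠ z in 𝓝[P.S j] v, |P.H z| < ρ' := by
      have hc : ContinuousWithinAt (fun z ↦ |P.H z|) (P.S j) v := hH.abs
      have := hc.eventually (Iio_mem_nhds (show |P.H v| < ρ' by rw [P.H_v, abs_zero]; exact hρ'))
      exact this
    obtain ⟨U, hU, hUS⟩ := eventually_nhdsWithin_iff.1 (h₁.and h₂) |>.exists_mem
    exact ⟨U, hU, fun z hz hzS ↦ ⟨(hUS z hz hzS).1.le, (hUS z hz hzS).2.le⟩⟩
  choose U hU hUspec using hsmall
  have hfin : (⋂ j, U j) ∈ 𝓝 v := (Filter.iInter_mem).2 hU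
  filter_upwards [inter_mem hfin P.iUnion_mem_nhds] with z ⟨hzU, hzS⟩
  obtain ⟨j, hj⟩ := mem_iUnion.1 hzS
  exact mem_iUnion.2 ⟨j, hj, hUspec j z (mem_iInter.1 hzU j) hj⟩

/-- **The shrunk star.** [folklore] -/
def restrict [NeZero n] {ρ' : ℝ} (hρ' : 0 < ρ') (hle : ρ' ≤ P.ρ) : ProngStar F ι v n where
  S := P.subS ρ'
  b := P.b
  H := P.H
  sg := P.sg
  ρ := ρ'
  ρ_pos := hρ'
  sg_sq := P.sg_sq
  sg_succ := P.sg_succ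
  isCompact := P.isCompact_subS ρ'
  mem := P.mem_subS hρ'.le
  iUnion_mem_nhds := P.iUnion_subS_mem_nhds hρ'
  H_v := P.H_v
  b_v := P.b_v
  continuousOn_H j := (P.continuousOn_H j).mono (P.subS_subset ρ' j)
  continuousOn_b j := (P.continuousOn_b j).mono (P.subS_subset ρ' j)
  injOn j := (P.injOn j).mono (P.subS_subset ρ' j)
  image_eq j := by
    refine Subset.antisymm ?_ ?_
    · rintro _ ⟨z, hz, rfl⟩
      have hr := P.chart_mem_rect hz.1
      rw [mem_rect_iff] at hr
      exact ⟨⟨hr.1.1, hz.2.1⟩, abs_le.1 hz.2.2⟩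
    · rintro ⟨β, h⟩ ⟨hβ, hh⟩
      have hp : (β, h) ∈ P.rect := (P.mem_rect_iff).2 ⟨⟨hβ.1, hβ.2.trans hle⟩, ⟨by linarith [hh.1], hh.2.trans hle⟩⟩
      refine ⟨P.pt j (β, h), ⟨P.pt_mem hp, ?_, ?_⟩, ?_⟩
      · rw [P.b_pt hp]; exact hβ.2
      · rw [P.H_pt hp]; exact abs_le.2 ⟨hh.1, hh.2⟩
      · show P.chart j (P.pt j (β, h)) = (β, h)
        exact (P.pt_spec hp).2
  inter_succ j := by
    ext z
    constructor
    · rintro ⟨hz, hz'⟩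
      obtain ⟨hb, -, hs⟩ := P.b_eq_zero_of_mem_inter ⟨hz.1, hz'.1⟩
      exact ⟨hz, hb, hs⟩
    · rintro ⟨hz, hb, hs⟩
      have hz' : z ∈ P.S (j + 1) := P.mem_succ_of_b_eq_zero hz.1 hb hs
      obtain ⟨-, hb', -⟩ := P.b_eq_zero_of_mem_inter ⟨hz.1, hz'⟩
      exact ⟨hz, hz', by rw [hb']; exact hρ'.le, hz.2.2⟩
  inter_succ' j := by
    ext z
    constructor
    · rintro ⟨hz, hz'⟩
      obtain ⟨-, hb', hs⟩ := P.b_eq_zero_of_mem_inter ⟨hz.1, hz'.1⟩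
      exact ⟨hz', hb', hs⟩
    · rintro ⟨hz', hb', hs⟩
      have hz : z ∈ P.S j := P.mem_of_b_succ_eq_zero hz'.1 hb' hs
      obtain ⟨hb, -, -⟩ := P.b_eq_zero_of_mem_inter ⟨hz, hz'.1⟩
      exact ⟨⟨hz, by rw [hb]; exact hρ'.le, hz'.2.2⟩, hz'⟩
  axis_subset j := by
    rintro z ⟨hz, hb⟩
    rcases P.mem_neighbour_of_b_eq_zero hz.1 hb with h | h
    · left
      have hz' : z ∈ P.S (j - 1) ∩ P.S (j - 1 + 1) := by rw [sub_add_cancel]; exact ⟨h, hz.1⟩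
      obtain ⟨hb', -, -⟩ := P.b_eq_zero_of_mem_inter hz'
      exact ⟨h, by rw [hb']; exact hρ'.le, hz.2.2⟩
    · right
      obtain ⟨-, hb', -⟩ := P.b_eq_zero_of_mem_inter ⟨hz.1, h⟩
      exact ⟨h, by rw [hb']; exact hρ'.le, hz.2.2⟩
  eq_of_mem_inter i j z hz hne := P.eq_of_mem_inter i j z ⟨hz.1.1, hz.2.1⟩ hne
  diff_subset_range j := fun z hz ↦ P.diff_subset_range j ⟨hz.1.1, hz.2⟩
  not_mem_range := P.not_mem_range
  foliated j x hx := by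
    obtain ⟨e, he, hxe, U, hU, h⟩ := P.foliated j x hx.1
    exact ⟨e, he, hxe, U, hU, fun y hy hyS z hz hzS ↦ h y hy hyS.1 z hz hzS.1⟩

/-- The sectors of the shrunk star. [folklore] -/
@[simp] theorem restrict_S [NeZero n] {ρ' : ℝ} (hρ' : 0 < ρ') (hle : ρ' ≤ P.ρ) (j : ZMod n) :
    (P.restrict hρ' hle).S j = P.subS ρ' j := rfl

/-- The coordinates of the shrunk star. [folklore] -/
@[simp] theorem restrict_b [NeZero n] {ρ' : ℝ} (hρ' : 0 < ρ') (hle : ρ' ≤ P.ρ) : (P.restrict hρ' hle).b = P.b := rfl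

/-- The height of the shrunk star. [folklore] -/
@[simp] theorem restrict_H [NeZero n] {ρ' : ℝ} (hρ' : 0 < ρ') (hle : ρ' ≤ P.ρ) : (P.restrict hρ' hle).H = P.H := rfl

/-- The signs of the shrunk star. [folklore] -/
@[simp] theorem restrict_sg [NeZero n] {ρ' : ℝ} (hρ' : 0 < ρ') (hle : ρ' ≤ P.ρ) : (P.restrict hρ' hle).sg = P.sg := rfl

/-- The size of the shrunk star. [folklore] -/
@[simp] theorem restrict_ρ [NeZero n] {ρ' : ℝ} (hρ' : 0 < ρ') (hle : ρ' ≤ P.ρ) : (P.restrict hρ' hle).ρ = ρ' := rfl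

/-- The sectors of the shrunk star lie in the original sectors. [folklore] -/
theorem restrict_S_subset [NeZero n] {ρ' : ℝ} (hρ' : 0 < ρ') (hle : ρ' ≤ P.ρ) (j : ZMod n) :
    (P.restrict hρ' hle).S j ⊆ P.S j := P.subS_subset ρ' j

/-- Only `v` lies in all the shrunk sectors `subS ρ' j`, `ρ' > 0`. [folklore] -/
theorem eq_of_forall_mem_subS {j : ZMod n} {z : ℂ} (h : ∀ ρ' > 0, z ∈ P.subS ρ' j) : z = v := by
  have hz : z ∈ P.S j := (h 1 one_pos).1
  have hb : P.b j z = 0 := by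
    have h0 : 0 ≤ P.b j z := ((P.mem_rect_iff).1 (P.chart_mem_rect hz)).1.1
    refine le_antisymm (le_of_forall_pos_le_add fun ε hε ↦ ?_) h0
    rw [zero_add]; exact (h ε hε).2.1
  have hH : P.H z = 0 := by
    refine abs_nonpos_iff.1 (le_of_forall_pos_le_add fun ε hε ↦ ?_)
    rw [zero_add]; exact (h ε hε).2.2
  refine P.injOn j hz (P.mem j) ?_
  simp only [hb, hH, P.b_v, P.H_v]

/-- **Small shrunk stars lie in any neighbourhood of `v`.** [folklore] -/
theorem exists_restrict_subset [NeZero n] {U : Set ℂ} (hU : U ∈ 𝓝 v) :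
    ∃ ρ', ∃ (hρ' : 0 < ρ') (hle : ρ' ≤ P.ρ), ∀ j, (P.restrict hρ' hle).S j ⊆ U := by
  obtain ⟨O, hOU, hO, hvO⟩ := _root_.mem_nhds_iff.1 hU
  -- for each sector, a nested family of compact sets with intersection `{v}`
  have key : ∀ j, ∃ ρ' ∈ Ioc 0 P.ρ, P.subS ρ' j ⊆ O := by
    intro j
    set V : {ρ' : ℝ // 0 < ρ'} → Set ℂ := fun ρ' ↦ P.subS (min ρ'.1 P.ρ) j with hV
    haveI : Nonempty {ρ' : ℝ // 0 < ρ'} := ⟨⟨1, one_pos⟩⟩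
    have hdir : Directed (· ⊇ ·) V := by
      rintro ⟨a, ha⟩ ⟨b, hb⟩
      refine ⟨⟨min a b, lt_min ha hb⟩, ?_, ?_⟩ <;> intro z hz <;>
        refine ⟨hz.1, hz.2.1.trans ?_, hz.2.2.trans ?_⟩ <;> simp only
      exacts [min_le_min_right _ (min_le_left a b), min_le_min_right _ (min_le_left a b),
        min_le_min_right _ (min_le_right a b), min_le_min_right _ (min_le_right a b)]
    have hcpt : ∀ i, IsCompact (V i) := fun i ↦ P.isCompact_subS _ j
    have hsub : ⋂ i, V i ⊆ O := by
      intro z hz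
      have : z = v := P.eq_of_forall_mem_subS (j := j) fun ρ' hρ' ↦ by
        have h := mem_iInter.1 hz ⟨ρ', hρ'⟩
        exact ⟨h.1, h.2.1.trans (min_le_left _ _), h.2.2.trans (min_le_left _ _)⟩
      rw [this]; exact hvO
    obtain ⟨⟨ρ', hρ'⟩, h⟩ := exists_subset_nhds_of_isCompact' hdir hcpt (fun i ↦ (hcpt i).isClosed)
      (fun z hz ↦ hO.mem_nhds (hsub hz))
    exact ⟨min ρ' P.ρ, ⟨lt_min hρ' P.ρ_pos, min_le_right _ _⟩, h⟩
  choose r hr hrO using key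
  obtain ⟨j₀, -, hj₀⟩ := Finset.exists_min_image Finset.univ r Finset.univ_nonempty
  refine ⟨r j₀, (hr j₀).1, (hr j₀).2, fun j z hz ↦ hOU (hrO j ⟨hz.1, hz.2.1.trans (hj₀ j (Finset.mem_univ j)),
    hz.2.2.trans (hj₀ j (Finset.mem_univ j))⟩)⟩

end ProngStar

end Literature.Topology.PlanarFoliations
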